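/-
Copyright (c) 2026 the pub-hodgecm-mathlib formalisation cell (harness21).  Prover seat hodgecm-mathlib-K2Liu-p06 (g3): Track B «K2-LIT»,
hLiu418 = stmt-HodgeConjecture-24832, LEAD F0P6-plan (g12) words 2026-09-04T06:45:31Z «(ii) B2c Bruhat EXHAUSTION» and 06:51:40Z «= GO (X1)+(X2) NOW»:
steps (X1) (rank normal form) and (X3) (middle-cell factorisation in the frame); 2026-09-04.
-/
import Mathlib.LinearAlgebra.Matrix.Transvection
import Summits.HodgeConjecture.HodgeConjecture.Theorems.K2LiuSiegelBruhatMiddleCell      -- ★ B2a `reflFrame_mul_self`, `eq_zero_of_neg_two_smul_eq_zero`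
import Summits.HodgeConjecture.HodgeConjecture.Theorems.K2LiuSiegelBruhatCellsUnitary    -- ★ B1 `conjTranspose_fromBlocks`, `unip_mul_unip_neg`
import HarnessLib

/-!
# Crux `HLiu418`, ROAD Φ ∕ organ O41.1 B2c (Bruhat exhaustion for `P_Δ\H/P_Δ`): (X1) THE RANK NORMAL FORM OF THE `C`-BLOCK (over a field every
# square matrix is `d·(−2E_J)·a`, `E_J = diag(𝟙_J)` a `0∕1` idempotent) and (X3) THE MIDDLE-CELL FACTORISATION `F = n(−X)·W_E·P` OF A UNITARY FRAME WITH `C = −2E`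

Cell `hodgecm-mathlib`, crux item hLiu418 = `stmt-HodgeConjecture-24832`, route `HCCMUnconditional`; squad K2 ∕ K2Liu, LEAD F0P6-plan (g12), prover K2Liu-p06 (g3).
THEOREMS ONLY (imports ★ B2a `K2LiuSiegelBruhatMiddleCell`, ★ B1 `K2LiuSiegelBruhatCellsUnitary`, Mathlib transvections; no `def`, no instance, no notation,
no `sorry`, default heartbeats); lane `--supports stmt-HodgeConjecture-24832 --as helper` (count-neutral).

WHY.  The double cosets `P_Δ(L⁺)\H(L⁺)/P_Δ(L⁺)` are read off the lower-left frame block `C` (★ `K2LiuSiegelBruhatCells`: `C ↦ d·C·a'` under `P × P`, rank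
invariant; `C = 0` ⇔ `P_Δ`; `C` invertible ⇔ big cell), and the reflection representatives `w_g`, `G = 1 − 2E_J`, have `C = −2E_J` (★ B2a `toBlocks₂₁_reflFrame`).
Step (X1) of the exhaustion: every `C ∈ M_n(K)` (`K` a field, `2 ≠ 0` not even needed) is `d · C · a = −2 · diag(𝟙_J)` for invertible `d, a` and a
subset `J` (`|J| = rank C`): Gaussian elimination by transvections (Mathlib `Matrix.Pivot.exists_list_transvec_mul_mul_list_transvec_eq_diagonal`)
followed by a diagonal rescaling of the non-zero pivots to `−2`.

* §1 **`exists_mul_mul_eq_neg_two_smul_diagonal`**: `∃ d a χ, IsUnit d.det ∧ IsUnit a.det ∧ (∀ k, χ k = 0 ∨ χ k = 1) ∧ d * C * a = -(2 • diagonal χ)` — the pattern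
  is a `0∕1`-valued function `χ : n → K`, the currency of ★ Φ2 file 5 (`K2LiuSiegelMiddleStabilizerNontrivial`); `diagonal_zero_one_idem` (`diag(χ)² = diag(χ)`);
  `eq_zero_of_normalForm_zero` (`χ ≡ 0 ⇒ C = 0`), `exists_apply_eq_zero_of_not_isUnit` (`det C ∉ Kˣ ⇒ ∃ k, χ k = 0` — a middle or small cell).
* §2 THE MIDDLE-CELL FACTORISATION IN THE FRAME (any commutative ring `R` with involution `σ`, `2 ∈ Rˣ`; frame form `J_F = (0 −J; −J −J)` of ★ B1):
  for a UNITARY frame `F = (A B; −2E D)` whose `C`-block is ALREADY the normal form `−2E` (`E² = E = σ(E) = Eᵀ`, `EJ = JE`):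
  `upperLeft_relation` (the `(1,1)` block `A^*JC + C^*JA + C^*JC = 0` of unitarity), **`corner_mul_eq_zero_of_unitary`** (`E A (1 − E) = 0`),
  **`skew_half_corner_of_unitary`** (`X := ⅟2 (EAE − E)` is `J`-skew: `JX + X^*J = 0`), **`toBlocks₂₁_reflFrame_mul_unip_mul_eq_zero`**
  (`W_E · n(X) · F` has lower-left block `0`), `eq_unip_mul_reflFrame_mul` (`F = n(−X) · W_E · (W_E n(X) F)`): so `F ∈ N_Δ · w_E · P_Δ` — with (X1) and the
  Levi action `C ↦ d C a` (★ Part A) this is the exhaustion `H = ⨆_E P_Δ w_E P_Δ` (the `H(𝔸)`∕`H(L⁺)` transport is the sequel `K2LiuSiegelBruhatMiddleCellExhaustion`).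
[GelbartPiatetskishapiroRallis1987, Part A §1 (cells ↔ rank)], [MoeglinWaldspurger1995, II.1.7].

HONEST LABEL.  Count-neutral helper; `HC_CM` is proved only modulo the 7 printed citations (2 remaining named inputs: hLiu418 = `stmt-HodgeConjecture-24832`,
h413 = `stmt-HodgeConjecture-24833`) until rung 0 closes.
-/

set_option autoImplicit false
set_option linter.dupNamespace false -- the mandated namespace repeats `HodgeConjecture.HodgeConjecture`

namespace Summit.HodgeConjecture.HodgeConjecture.Cruxes.HLiu418.K2LiuSiegelBruhatRankNormalForm

open Matrix

/-! ## §1 The rank normal form `d · C · a = −2 · diag(χ)` over a field -/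

section Field

variable {K : Type*} [Field K] [NeZero (2 : K)] {n : Type*} [Fintype n] [DecidableEq n]

omit [NeZero (2 : K)] in
/-- a `0∕1` diagonal matrix is idempotent. [folklore] -/
theorem diagonal_zero_one_idem {χ : n → K} (hχ : ∀ k, χ k = 0 ∨ χ k = 1) : diagonal χ * diagonal χ = diagonal χ := by
  rw [diagonal_mul_diagonal]
  congr 1
  funext k
  rcases hχ k with h | h <;> simp [h]

/-- **rescaling a diagonal matrix to a `0∕1` pattern**: for `D : n → K` there is an invertible diagonal `s` with `diag(s) · diag(D) = −2 · diag(χ)`,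
`χ k = 1` if `D k ≠ 0` and `χ k = 0` otherwise. [folklore] -/
theorem exists_diagonal_mul_eq_neg_two_smul (D : n → K) :
    ∃ (s χ : n → K), (∀ k, s k ≠ 0) ∧ (∀ k, χ k = 0 ∨ χ k = 1) ∧ (∀ k, χ k = 1 ↔ D k ≠ 0) ∧
      diagonal s * diagonal D = -((2 : K) • diagonal χ) := by
  classical
  refine ⟨fun k => if D k = 0 then 1 else -2 * (D k)⁻¹, fun k => if D k = 0 then 0 else 1, fun k => ?_, fun k => ?_, fun k => ?_, ?_⟩
  · by_cases h : D k = 0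
    · simp [h]
    · simp only [h, if_false]
      exact mul_ne_zero (neg_ne_zero.2 two_ne_zero) (inv_ne_zero h)
  · by_cases h : D k = 0 <;> simp [h]
  · by_cases h : D k = 0 <;> simp [h]
  · rw [diagonal_mul_diagonal, ← diagonal_smul, diagonal_neg]
    congr 1
    funext k
    by_cases h : D k = 0
    · simp [h]
    · simp only [h, if_false, Pi.smul_apply, smul_eq_mul, mul_one]
      rw [mul_assoc, inv_mul_cancel₀ h, mul_one]

/-- **(X1) THE RANK NORMAL FORM**: for every `C ∈ M_n(K)` over a field there are invertible `d, a ∈ M_n(K)` and a `0∕1` pattern `χ` with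
`d · C · a = −2 · diag(χ)` (Gaussian elimination by transvections + pivot rescaling).  `diag(χ)` is the corner idempotent of the reflection `G = 1 − 2 diag(χ)`;
`χ ≡ 0` iff `C = 0` (the small cell) and `χ ≡ 1` iff `C` is invertible (the big cell). [cite: GelbartPiatetskishapiroRallis1987, Part A §1]
[cite: MoeglinWaldspurger1995, II.1.7] -/
theorem exists_mul_mul_eq_neg_two_smul_diagonal (C : Matrix n n K) :
    ∃ (d a : Matrix n n K) (χ : n → K), IsUnit d.det ∧ IsUnit a.det ∧ (∀ k, χ k = 0 ∨ χ k = 1) ∧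
      d * C * a = -((2 : K) • diagonal χ) := by
  obtain ⟨L, L', D, hD⟩ := Matrix.Pivot.exists_list_transvec_mul_mul_list_transvec_eq_diagonal C
  obtain ⟨s, χ, hs, hχ, -, hsD⟩ := exists_diagonal_mul_eq_neg_two_smul D
  refine ⟨diagonal s * (L.map Matrix.TransvectionStruct.toMatrix).prod, (L'.map Matrix.TransvectionStruct.toMatrix).prod, χ, ?_, ?_, hχ, ?_⟩
  · rw [det_mul, Matrix.TransvectionStruct.det_toMatrix_prod, mul_one, det_diagonal]
    exact IsUnit.mk0 _ (Finset.prod_ne_zero_iff.2 fun k _ => hs k)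
  · rw [Matrix.TransvectionStruct.det_toMatrix_prod]; exact isUnit_one
  · calc diagonal s * (L.map Matrix.TransvectionStruct.toMatrix).prod * C * (L'.map Matrix.TransvectionStruct.toMatrix).prod
        = diagonal s * ((L.map Matrix.TransvectionStruct.toMatrix).prod * C * (L'.map Matrix.TransvectionStruct.toMatrix).prod) := by
          simp only [Matrix.mul_assoc]
      _ = _ := by rw [hD, hsD]

omit [NeZero (2 : K)] in
/-- the small-cell pattern: `χ ≡ 0 ⟹ C = 0`. [cite: GelbartPiatetskishapiroRallis1987, Part A §1] -/
theorem eq_zero_of_normalForm_zero {C d a : Matrix n n K} (hd : IsUnit d.det) (ha : IsUnit a.det) {χ : n → K} (hχ0 : ∀ k, χ k = 0)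
    (h : d * C * a = -((2 : K) • diagonal χ)) : C = 0 := by
  have hz : diagonal χ = 0 := by
    rw [show χ = 0 from funext hχ0]; exact diagonal_zero
  rw [hz, smul_zero, neg_zero] at h
  have h1 : C = d⁻¹ * (d * C * a) * a⁻¹ := by
    rw [Matrix.mul_assoc d, Matrix.nonsing_inv_mul_cancel_left d _ hd, Matrix.mul_nonsing_inv_cancel_right a _ ha]
  rw [h1, h, Matrix.mul_zero, Matrix.zero_mul]

/-- **off the big cell some pattern entry vanishes**: if `det C` is not a unit then `χ k = 0` for some `k` (otherwise `diag(χ) = 1` and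
`det d · det C · det a = det(−2·1)` would be a unit). [cite: GelbartPiatetskishapiroRallis1987, Part A §1] -/
theorem exists_apply_eq_zero_of_not_isUnit {C d a : Matrix n n K} {χ : n → K} (hχ : ∀ k, χ k = 0 ∨ χ k = 1)
    (h : d * C * a = -((2 : K) • diagonal χ)) (hC : ¬ IsUnit C.det) : ∃ k, χ k = 0 := by
  by_contra hne
  simp only [not_exists] at hne
  have h1 : diagonal χ = 1 := by
    rw [← diagonal_one]; congr 1; funext k
    rcases hχ k with h0 | h1
    · exact absurd h0 (hne k)
    · exact h1
  rw [h1] at h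
  have hu : IsUnit (d * C * a).det := by
    rw [h, det_neg, det_smul, det_one, mul_one]
    exact ((isUnit_one.neg).pow _).mul ((IsUnit.mk0 _ two_ne_zero).pow _)
  rw [det_mul, det_mul] at hu
  exact hC (isUnit_of_mul_isUnit_right (isUnit_of_mul_isUnit_left hu))

end Field

/-! ## §2 The middle-cell factorisation of a unitary frame whose `C`-block is the normal form `−2E` -/

section Frame

open K2LiuSiegelBruhatCellsUnitary K2LiuSiegelBruhatMiddleCell

variable {R : Type*} [CommRing R] {m : Type*} [Fintype m] [DecidableEq m] (σ : R →+* R)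

omit [DecidableEq m] in
/-- **The `(1,1)` column relation** of a unitary frame matrix `(A B; C D)` for `J_F = (0 −J; −J −J)`: `A^*JC + C^*JA + C^*JC = 0` (the `(1,1)` block of
`F^* J_F F = J_F`; `M^* = ᵗσ(M)`). [cite: GelbartPiatetskishapiroRallis1987, Part A §1] -/
theorem upperLeft_relation (J A B C D : Matrix m m R)
    (hF : ((fromBlocks A B C D).map σ)ᵀ * fromBlocks 0 (-J) (-J) (-J) * fromBlocks A B C D = fromBlocks 0 (-J) (-J) (-J)) :
    (A.map σ)ᵀ * J * C + (C.map σ)ᵀ * J * A + (C.map σ)ᵀ * J * C = 0 := by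
  rw [conjTranspose_fromBlocks, fromBlocks_multiply, fromBlocks_multiply] at hF
  simp only [Matrix.mul_zero, zero_add, Matrix.mul_neg, Matrix.add_mul, Matrix.neg_mul] at hF
  obtain ⟨h11, -, -, -⟩ := fromBlocks_inj.mp hF
  rw [← neg_eq_zero, ← h11]
  simp only [Matrix.mul_assoc]
  abel

/-- `σ` fixes `⅟2`. [folklore] -/
theorem map_invOf_two [Invertible (2 : R)] : σ (⅟ (2 : R)) = ⅟ (2 : R) := by
  refine (invOf_eq_left_inv ?_).symm
  calc σ (⅟ (2 : R)) * 2 = σ (⅟ (2 : R)) * σ 2 := by rw [map_ofNat]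
    _ = σ (⅟ (2 : R) * 2) := (map_mul σ _ _).symm
    _ = 1 := by rw [invOf_mul_self, map_one]

omit [Fintype m] [DecidableEq m] in
/-- `ᵗσ(−2E) = −2E` for `σ(E) = E = Eᵀ`. [folklore] -/
theorem conjTranspose_neg_two_smul {E : Matrix m m R} (hEσ : E.map σ = E) (hEt : Eᵀ = E) :
    ((-((2 : R) • E)).map σ)ᵀ = -((2 : R) • E) := by
  rw [Matrix.map_neg _ (map_neg σ), Matrix.map_smul σ (2 : R) (fun a => by rw [smul_eq_mul, smul_eq_mul, map_mul, map_ofNat]) E, hEσ,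
    transpose_neg, transpose_smul, hEt]

omit [CommRing R] [Fintype m] [DecidableEq m] in
/-- `τ(τ(X)) = X` entrywise for an involution `τ`. [folklore] -/
theorem map_map_invol {τ : R → R} (hτ : ∀ x, τ (τ x) = x) (X : Matrix m m R) : (X.map τ).map τ = X := by
  ext i j; simp [hτ]

omit [DecidableEq m] in
/-- **The basic relation of a unitary frame with `C = −2E`**: `A^* J E + E J A = 2 · E J E`. [cite: GelbartPiatetskishapiroRallis1987, Part A §1] -/
theorem conjTranspose_mul_add_eq_of_unitary [Invertible (2 : R)] {J E A B D : Matrix m m R} (hEσ : E.map σ = E) (hEt : Eᵀ = E)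
    (hF : ((fromBlocks A B (-((2 : R) • E)) D).map σ)ᵀ * fromBlocks 0 (-J) (-J) (-J) * fromBlocks A B (-((2 : R) • E)) D = fromBlocks 0 (-J) (-J) (-J)) :
    (A.map σ)ᵀ * J * E + E * J * A = (2 : R) • (E * J * E) := by
  have h := upperLeft_relation σ J A B _ D hF
  rw [conjTranspose_neg_two_smul σ hEσ hEt] at h
  simp only [Matrix.mul_neg, Matrix.neg_mul, Matrix.mul_smul, Matrix.smul_mul] at h
  -- `h : -(2 • (A^* J E)) + -(2 • (E J A)) + (2 * 2) • (E J E) = 0`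
  rw [← sub_eq_zero]
  refine eq_zero_of_neg_two_smul_eq_zero (R := R) ?_
  rw [← h]
  module

/-- **(a) `E A (1 − E) = 0`** for a unitary frame `(A B; −2E D)` (`J` invertible `σ`-hermitian, `E² = E = σ(E) = Eᵀ`, `EJ = JE`, `σ` an involution):
multiply the basic relation by `1 − E` on the left and take `^*`. [cite: GelbartPiatetskishapiroRallis1987, Part A §1] -/
theorem corner_mul_eq_zero_of_unitary [Invertible (2 : R)] {J E A B D : Matrix m m R} (hσ : ∀ x, σ (σ x) = x) (hJ : IsUnit J.det)
    (hJσ : J.map σ = J) (hJt : Jᵀ = J) (hE : E * E = E) (hEσ : E.map σ = E) (hEt : Eᵀ = E) (hEJ : E * J = J * E)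
    (hF : ((fromBlocks A B (-((2 : R) • E)) D).map σ)ᵀ * fromBlocks 0 (-J) (-J) (-J) * fromBlocks A B (-((2 : R) • E)) D = fromBlocks 0 (-J) (-J) (-J)) :
    E * A * (1 - E) = 0 := by
  have hR := conjTranspose_mul_add_eq_of_unitary σ hEσ hEt hF
  have h1E : (1 - E) * E = 0 := by rw [Matrix.sub_mul, Matrix.one_mul, hE, sub_self]
  -- left-multiply by `1 − E`
  have h2 : (1 - E) * (A.map σ)ᵀ * J * E = 0 := by
    have h := congrArg (fun Z => (1 - E) * Z) hR
    simp only [Matrix.mul_add, Matrix.mul_smul, ← Matrix.mul_assoc, h1E, Matrix.zero_mul, smul_zero, add_zero] at h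
    exact h
  -- take `^*`
  have h3 : E * (J * (A * (1 - E))) = 0 := by
    have h := congrArg (fun Z => (Z.map σ)ᵀ) h2
    simp only [Matrix.map_mul, Matrix.map_sub _ (map_sub σ), Matrix.map_one σ (map_zero σ) (map_one σ), transpose_map, map_map_invol hσ, hEσ, hJσ,
      transpose_mul, transpose_sub, transpose_one, transpose_transpose, hEt, hJt, Matrix.map_zero σ (map_zero σ), transpose_zero] at h
    simpa only [Matrix.mul_assoc] using h
  rw [← Matrix.mul_assoc, hEJ, Matrix.mul_assoc] at h3
  have hJu : IsUnit J := (Matrix.isUnit_iff_isUnit_det J).2 hJ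
  have h4 : E * (A * (1 - E)) = 0 := hJu.mul_right_inj.1 (h3.trans (Matrix.mul_zero J).symm)
  simpa only [Matrix.mul_assoc] using h4

omit [DecidableEq m] in
/-- **(b) the half corner `X = ⅟2 (E A E − E)` is `J`-skew**: `J X + X^* J = 0` (sandwich the basic relation between `E` and `E`).
[cite: GelbartPiatetskishapiroRallis1987, Part A §§1–2] [cite: KudlaRallis1994, §1] -/
theorem skew_half_corner_of_unitary [Invertible (2 : R)] {J E A B D : Matrix m m R}
    (hE : E * E = E) (hEσ : E.map σ = E) (hEt : Eᵀ = E) (hEJ : E * J = J * E)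
    (hF : ((fromBlocks A B (-((2 : R) • E)) D).map σ)ᵀ * fromBlocks 0 (-J) (-J) (-J) * fromBlocks A B (-((2 : R) • E)) D = fromBlocks 0 (-J) (-J) (-J)) :
    J * ((⅟ (2 : R)) • (E * A * E - E)) + (((⅟ (2 : R)) • (E * A * E - E)).map σ)ᵀ * J = 0 := by
  have hR := conjTranspose_mul_add_eq_of_unitary σ hEσ hEt hF
  -- sandwich between `E` and `E`
  have h2 : E * (A.map σ)ᵀ * J * E + E * J * A * E = (2 : R) • (E * J * E) := by
    have h := congrArg (fun Z => E * Z * E) hR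
    simp only [Matrix.mul_add, Matrix.add_mul, Matrix.mul_smul, Matrix.smul_mul, Matrix.mul_assoc, idem_mul_assoc hE, hE] at h
    simpa only [Matrix.mul_assoc] using h
  have hmap : (((⅟ (2 : R)) • (E * A * E - E)).map σ)ᵀ = (⅟ (2 : R)) • (E * (A.map σ)ᵀ * E - E) := by
    rw [Matrix.map_smul σ (⅟ (2 : R)) (fun a => by rw [smul_eq_mul, smul_eq_mul, map_mul, map_invOf_two]) _, Matrix.map_sub _ (map_sub σ), Matrix.map_mul,
      Matrix.map_mul, hEσ, transpose_smul, transpose_sub, transpose_mul, transpose_mul, hEt, Matrix.mul_assoc]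
  rw [hmap, Matrix.mul_smul, Matrix.smul_mul, ← smul_add, Matrix.mul_sub, Matrix.sub_mul]
  -- move `J` past `E`
  have hJE1 : J * (E * A * E) = E * J * A * E := by rw [Matrix.mul_assoc E A, ← Matrix.mul_assoc J, ← hEJ, Matrix.mul_assoc, Matrix.mul_assoc, Matrix.mul_assoc]
  have hJE2 : E * (A.map σ)ᵀ * E * J = E * (A.map σ)ᵀ * J * E := by rw [Matrix.mul_assoc _ E J, hEJ, ← Matrix.mul_assoc]
  have hJE3 : E * J * E = E * J := by rw [Matrix.mul_assoc, ← hEJ, ← Matrix.mul_assoc, hE]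
  rw [hJE1, hJE2, ← hEJ, show E * J * A * E - E * J + (E * (A.map σ)ᵀ * J * E - E * J) = (E * (A.map σ)ᵀ * J * E + E * J * A * E) - (2 : R) • (E * J) by module,
    h2, hJE3, sub_self, smul_zero]

omit [DecidableEq m] in
/-- `2 · (E X E) = E A E − E` for `X = ⅟2 (EAE − E)` (`E² = E`): the corner equation the unipotent correction must solve. [folklore] -/
theorem two_smul_corner_half [Invertible (2 : R)] {E : Matrix m m R} (hE : E * E = E) (A : Matrix m m R) :
    (2 : R) • (E * ((⅟ (2 : R)) • (E * A * E - E)) * E) = E * A * E - E := by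
  rw [Matrix.mul_smul, Matrix.smul_mul, smul_smul, mul_invOf_self, one_smul, Matrix.mul_sub, Matrix.sub_mul, hE,
    Matrix.mul_assoc E A E, idem_mul_assoc hE, Matrix.mul_assoc, Matrix.mul_assoc A E E, hE, ← Matrix.mul_assoc]

/-- **(c) the corrected frame lies in `W_E · P_Δ`**: if `E A (1 − E) = 0` and `2·(E X E) = E A E − E` then `W_E · n(X) · (A B; −2E D)` has lower-left block
`−2EA + 2E + 4EXE = −2 E A (1 − E) = 0`. [cite: GelbartPiatetskishapiroRallis1987, Part A §§1–2] [cite: MoeglinWaldspurger1995, II.1.7] -/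
theorem toBlocks₂₁_reflFrame_mul_unip_mul_eq_zero {E A B D X : Matrix m m R} (hE : E * E = E) (hA : E * A * (1 - E) = 0)
    (hX : (2 : R) • (E * X * E) = E * A * E - E) :
    (fromBlocks (1 : Matrix m m R) 0 (-((2 : R) • E)) (1 - (2 : R) • E) * fromBlocks 1 X 0 1 * fromBlocks A B (-((2 : R) • E)) D).toBlocks₂₁ = 0 := by
  rw [fromBlocks_multiply, fromBlocks_multiply, toBlocks_fromBlocks₂₁]
  simp only [Matrix.one_mul, Matrix.mul_one, Matrix.mul_zero, add_zero, Matrix.add_mul, Matrix.sub_mul, Matrix.mul_neg, Matrix.neg_mul,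
    Matrix.mul_smul, Matrix.smul_mul, Matrix.mul_assoc, hE]
  have hX' : (2 : R) • (E * (X * E)) = E * (A * E) - E := by simpa only [Matrix.mul_assoc] using hX
  have hA' : E * A = E * (A * E) := by
    rw [Matrix.mul_sub, Matrix.mul_one, sub_eq_zero] at hA
    rw [← Matrix.mul_assoc]; exact hA
  rw [hX', hA']
  module

/-- **(d) THE MIDDLE-CELL FACTORISATION**: `F = n(−X) · W_E · (W_E · n(X) · F)` (`W_E² = 1`, `n(−X) n(X) = 1`) — with (a)–(c), a unitary frame with
`C = −2E` lies in `N_Δ · w_E · P_Δ`. [cite: GelbartPiatetskishapiroRallis1987, Part A §§1–2] -/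
theorem eq_unip_mul_reflFrame_mul {E : Matrix m m R} (hE : E * E = E) (X : Matrix m m R) (F : Matrix (m ⊕ m) (m ⊕ m) R) :
    F = fromBlocks 1 (-X) 0 1 * fromBlocks (1 : Matrix m m R) 0 (-((2 : R) • E)) (1 - (2 : R) • E) *
      (fromBlocks (1 : Matrix m m R) 0 (-((2 : R) • E)) (1 - (2 : R) • E) * fromBlocks 1 X 0 1 * F) := by
  calc F = (fromBlocks 1 (-X) 0 1 * fromBlocks 1 X 0 1) * F := by
          rw [unip_mul_unip, neg_add_cancel, fromBlocks_one, Matrix.one_mul]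
    _ = fromBlocks 1 (-X) 0 1 * (fromBlocks (1 : Matrix m m R) 0 (-((2 : R) • E)) (1 - (2 : R) • E) *
          fromBlocks (1 : Matrix m m R) 0 (-((2 : R) • E)) (1 - (2 : R) • E)) * fromBlocks 1 X 0 1 * F := by
          rw [reflFrame_mul_self hE, Matrix.mul_one]
    _ = _ := by simp only [Matrix.mul_assoc]

end Frame

end Summit.HodgeConjecture.HodgeConjecture.Cruxes.HLiu418.K2LiuSiegelBruhatRankNormalForm
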